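import Literature.MathematicalPhysics.QuantumLattice.GibbsEnergyEntropyBalance
import HarnessLib

/-!
# MATRIX energy–entropy-balance cuts for canonical Gibbs eigen-mixtures: validity from a
# one-parameter semidefinite condition

Topic `Literature/MathematicalPhysics/QuantumLattice`; matrix generalisation of
`GibbsEnergyEntropyBalance.lean` (the scalar linearised Araki–Sewell rows). Fawzi–Fawzi–Scalet's
certified thermal relaxations constrain, for a finite family of generators `a₁ … a_m`, the moment
matrices `A_ij = ω(a_i⋆a_j)`, `B_ij = ω(a_j a_i⋆)`, `C_ij = ω(a_i⋆[H, a_j])` of a `β`-KMS state by the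
MATRIX energy–entropy balance `D_op(A‖B) ⪯ βC` (Thm. 3.4; operator relative entropy), relaxed to LMIs by
rational upper models of the logarithm (Fawzi–Saunderson–Parrilo). A dual certificate then contains rows
`tr(Λ_A A) + tr(Λ_B B) + β tr(Λ_C C) ≥ 0`, i.e. nonnegativity of the MATRIX CUT

  `R = Σ_{ij} (Λ_A)_{ij} a_iᴴ a_j + (Λ_B)_{ij} a_j a_iᴴ + β (Λ_C)_{ij} a_iᴴ (H a_j − a_j H)`

in the state. This file PROVES the validity of such rows for Gibbs eigen-mixtures DIRECTLY — no operator
convexity, no logarithm: in the energy eigenbasis the Gibbs value of `R` is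
`Σ_{b,c} e^{−βE_c} · u_{bc}⋆ (Λ_A + e^{−x_{bc}} Λ_B + x_{bc} Λ_C) u_{bc}` (`x_{bc} = β(E_b − E_c)`,
`(u_{bc})_j = ⟨v_b, a_j v_c⟩`), so it is `≥ 0` as soon as

  `Λ_A + e^{−x} Λ_B + x Λ_C ⪰ 0` for every real `x`        (ONE-PARAMETER SEMIDEFINITE CONDITION).

* §1 `sum_exp_mul_re_expect_matrixCut_nonneg` — full space, Boltzmann weights (any Hermitian `H`, any
  generators, any real `β`).
* §2 `posSemidef_tangent_triple` — the scalar tangent rows are the `1 × 1` cuts `(−s, q, 1)`,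
  `e^{s−1} ≤ q` (`sub_add_mul_exp_neg_nonneg_of_exp_le`); genuinely matrix triples (the dual rows of the
  LMI-relaxed matrix EEB, which are NOT sums of scalar tangent rows) are covered by the same theorem,
  their one-parameter condition being what a reader has to certify per row.
* §3 `sum_canonicalWeight_mul_re_expect_matrixCut_nonneg` — the canonical SECTOR eigen-mixture
  (`canonicalWeight`, `sectorEigenvector` of `TorusSectorGibbsMixture.lean`) for generators `a_i` such
  that `a_i` and `a_iᴴ` preserve the sector (gauge-invariant generators of a canonical state).

Everything is PROVED; no definition, no named fact. The torus / torus-limit packaging (one matrix-cut row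
= one «extra row `G_e`» of `HubbardTTPrimeThermalWindowCertificate.lean`) follows in a companion file.

## Mathlib / tree search

REUSED: Mathlib `Matrix.PosSemidef.dotProduct_mulVec_nonneg`, `Matrix.PosSemidef.one`, `.smul`,
`Matrix.IsHermitian.eigenvectorUnitary(_apply)`, `.mulVec_eigenvectorBasis`; tree
`sub_add_mul_exp_neg_nonneg_of_exp_le`, `mul_apply_eq_zero_off` (`GibbsEnergyEntropyBalance`),
`sectorExtend/sectorEigenvector/canonicalWeight` (`TorusSectorGibbsMixture`).
`lean search 'matrixCut|D_op|operator relative entropy'`: only the docstring mention in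
`EnergyEntropyBalance.lean` ("not needed for scalar rows"); no matrix EEB rows in the tree (2026-08-26).

## References

* H. Fawzi, O. Fawzi, S. O. Scalet, Nat. Commun. 15 (2024) 7394 = arXiv:2311.18706, §3.2 Thm. 3.4
  (matrix EEB `D_op(A‖B) ⪯ βC`), Prop. 3.5, (opt2). [cite: FawziFawziScalet2024, Thm. 3.4]
* H. Fawzi, J. Saunderson, P. A. Parrilo, Found. Comput. Math. 19 (2019) 259, Thm. 3 (semidefinite
  upper models of the matrix logarithm). [cite: FawziSaundersonParrilo2019, Thm. 3]
* O. Bratteli, D. W. Robinson, *OAQSM 2* (1997), Thm. 5.3.15. [cite: BratteliRobinsonII1997, Thm. 5.3.15]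
-/

noncomputable section

namespace Literature.MathematicalPhysics.QuantumLattice

open Matrix Finset
open scoped ComplexOrder BigOperators

section FullSpace

variable {κ : Type*} [Fintype κ] [DecidableEq κ]
variable {m : Type*} [Fintype m]

omit [DecidableEq κ] in
/-- A diagonal entry of `Vᴴ X V`. [folklore] -/
private theorem conjTranspose_mul_mul_apply_same'' (V X : Matrix κ κ ℂ) (c : κ) :
    (Vᴴ * X * V) c c = star (fun i => V i c) ⬝ᵥ (X *ᵥ fun i => V i c) := by
  rw [Matrix.mul_assoc, Matrix.mul_apply]
  simp only [conjTranspose_apply, dotProduct, Pi.star_apply, mulVec, Matrix.mul_apply]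

/-- **Matrix energy–entropy-balance cuts for the canonical eigen-mixture of a Hermitian matrix
(Boltzmann weights, unnormalised).** Let `H` be Hermitian with Mathlib eigenbasis `v_c` and eigenvalues
`E_c`, `a : m → Matrix` a finite family of generators, `β` real, and `Λ_A, Λ_B, Λ_C` complex `m × m`
matrices such that the ONE-PARAMETER family `Λ_A + e^{−x} Λ_B + x Λ_C` is positive semidefinite for every
real `x`. Then the MATRIX CUT
`R = Σ_{ij} (Λ_A)_{ij} a_iᴴ a_j + (Λ_B)_{ij} a_j a_iᴴ + β (Λ_C)_{ij} a_iᴴ (H a_j − a_j H)`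
is nonnegative in the Gibbs mixture: `0 ≤ Σ_c e^{−βE_c} Re⟨v_c, R v_c⟩`. In the eigenbasis the sum is
`Σ_{b,c} e^{−βE_c} · u_{bc}⋆ (Λ_A + e^{−x_{bc}} Λ_B + x_{bc} Λ_C) u_{bc}`, `x_{bc} = β(E_b − E_c)`,
`(u_{bc})_j = ⟨v_b, a_j v_c⟩` — termwise `≥ 0`. For `m = 1`, `(Λ_A, Λ_B, Λ_C) = (−s, q, 1)` with
`e^{s−1} ≤ q` this is the linear (tangent) row of `GibbsEnergyEntropyBalance.lean`; genuinely matrix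
triples are the dual rows of the MATRIX energy–entropy-balance constraint `D_op(A‖B) ⪯ βC` of
Fawzi–Fawzi–Scalet (Thm. 3.4) and its Gauss–Radau LMI relaxations, whose validity for Gibbs states is thus
reduced to the displayed one-parameter semidefinite condition — no operator convexity is used.
[cite: FawziFawziScalet2024, Thm. 3.4] -/
theorem sum_exp_mul_re_expect_matrixCut_nonneg {H : Matrix κ κ ℂ} (hH : H.IsHermitian)
    (a : m → Matrix κ κ ℂ) (β : ℝ) {ΛA ΛB ΛC : Matrix m m ℂ}
    (hΛ : ∀ x : ℝ, (ΛA + ((Real.exp (-x) : ℝ) : ℂ) • ΛB + ((x : ℝ) : ℂ) • ΛC).PosSemidef) :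
    0 ≤ ∑ c, Real.exp (-(β * hH.eigenvalues c)) *
      (star (fun i => (hH.eigenvectorUnitary : Matrix κ κ ℂ) i c) ⬝ᵥ
        ((∑ i, ∑ j, (ΛA i j • ((a i)ᴴ * a j) + ΛB i j • (a j * (a i)ᴴ) +
            ((β : ℝ) : ℂ) • (ΛC i j • ((a i)ᴴ * (H * a j - a j * H))))) *ᵥ
          fun i => (hH.eigenvectorUnitary : Matrix κ κ ℂ) i c)).re := by
  set V : Matrix κ κ ℂ := (hH.eigenvectorUnitary : Matrix κ κ ℂ) with hV
  set E : κ → ℝ := hH.eigenvalues with hE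
  set R : Matrix κ κ ℂ := ∑ i, ∑ j, (ΛA i j • ((a i)ᴴ * a j) + ΛB i j • (a j * (a i)ᴴ) +
      ((β : ℝ) : ℂ) • (ΛC i j • ((a i)ᴴ * (H * a j - a j * H)))) with hR
  -- unitarity and `H V = V D`
  have hVV : Vᴴ * V = 1 := by
    have h := Matrix.mem_unitaryGroup_iff'.1 hH.eigenvectorUnitary.2
    rwa [Matrix.star_eq_conjTranspose] at h
  have hVV' : V * Vᴴ = 1 := by
    have h := Matrix.mem_unitaryGroup_iff.1 hH.eigenvectorUnitary.2
    rwa [Matrix.star_eq_conjTranspose] at h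
  set D : Matrix κ κ ℂ := diagonal (fun b => ((E b : ℝ) : ℂ)) with hD
  have hHV : H * V = V * D := by
    ext i c
    have hcol : (fun b => V b c) = ⇑(hH.eigenvectorBasis c) := funext fun b => by
      rw [hV, Matrix.IsHermitian.eigenvectorUnitary_apply]
    have h := hH.mulVec_eigenvectorBasis c
    rw [← hcol] at h
    have hi := congrFun h i
    simp only [mulVec, dotProduct, Pi.smul_apply] at hi
    rw [hD, mul_diagonal, Matrix.mul_apply, hi, RCLike.real_smul_eq_coe_mul, mul_comm]
    rfl
  have hD' : Vᴴ * H * V = D := by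
    rw [Matrix.mul_assoc, hHV, ← Matrix.mul_assoc, hVV, Matrix.one_mul]
  -- the generators in the eigenbasis
  set C : m → Matrix κ κ ℂ := fun i => Vᴴ * a i * V with hC
  have hCt : ∀ i, (C i)ᴴ = Vᴴ * (a i)ᴴ * V := fun i => by
    rw [hC]
    dsimp only
    rw [conjTranspose_mul, conjTranspose_mul, conjTranspose_conjTranspose, Matrix.mul_assoc]
  have hconj : ∀ Y Z : Matrix κ κ ℂ, Vᴴ * (Y * Z) * V = (Vᴴ * Y * V) * (Vᴴ * Z * V) := by
    intro Y Z
    calc Vᴴ * (Y * Z) * V = Vᴴ * (Y * (V * Vᴴ) * Z) * V := by rw [hVV', Matrix.mul_one]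
      _ = (Vᴴ * Y * V) * (Vᴴ * Z * V) := by simp only [Matrix.mul_assoc]
  -- the three bilinear pieces in the eigenbasis (`w c = e^{-βE_c}`, `s i j b c = conj(Cⁱ_{bc}) Cʲ_{bc}`)
  set w : κ → ℂ := fun c => ((Real.exp (-(β * E c)) : ℝ) : ℂ) with hw
  have tA : ∀ i j, ∑ c, w c * (Vᴴ * ((a i)ᴴ * a j) * V) c c = ∑ c, ∑ b, w c * (star (C i b c) * C j b c) := by
    intro i j
    refine Finset.sum_congr rfl fun c _ => ?_
    rw [hconj, ← hCt, Matrix.mul_apply, Finset.mul_sum]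
    refine Finset.sum_congr rfl fun b _ => ?_
    rw [conjTranspose_apply]
  have tB : ∀ i j, ∑ c, w c * (Vᴴ * (a j * (a i)ᴴ) * V) c c = ∑ c, ∑ b, w b * (star (C i b c) * C j b c) := by
    intro i j
    have h1 : ∀ c, (Vᴴ * (a j * (a i)ᴴ) * V) c c = ∑ b, C j c b * star (C i c b) := by
      intro c
      rw [hconj, ← hCt, Matrix.mul_apply]
      refine Finset.sum_congr rfl fun b _ => ?_
      rw [conjTranspose_apply]
    simp_rw [h1, Finset.mul_sum]
    rw [Finset.sum_comm]
    refine Finset.sum_congr rfl fun c _ => Finset.sum_congr rfl fun b _ => ?_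
    ring
  have tC : ∀ i j, ∑ c, w c * (Vᴴ * ((a i)ᴴ * (H * a j - a j * H)) * V) c c =
      ∑ c, ∑ b, w c * (((E b - E c : ℝ) : ℂ) * (star (C i b c) * C j b c)) := by
    intro i j
    refine Finset.sum_congr rfl fun c _ => ?_
    have h1 : Vᴴ * ((a i)ᴴ * (H * a j - a j * H)) * V = (C i)ᴴ * (D * C j - C j * D) := by
      rw [hconj, ← hCt, Matrix.mul_sub, Matrix.sub_mul, hconj, hconj, hD']
    rw [h1, Matrix.mul_apply, Finset.mul_sum]
    refine Finset.sum_congr rfl fun b _ => ?_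
    rw [conjTranspose_apply, Matrix.sub_apply, hD, diagonal_mul, mul_diagonal, Complex.ofReal_sub]
    ring
  -- quadratic forms in `u_{bc} = (Cʲ_{bc})_j`
  have hquad : ∀ (M : Matrix m m ℂ) (b c : κ),
      ∑ i, ∑ j, M i j * (star (C i b c) * C j b c) = star (fun j => C j b c) ⬝ᵥ (M *ᵥ fun j => C j b c) := by
    intro M b c
    simp only [dotProduct, mulVec, Pi.star_apply, Finset.mul_sum]
    refine Finset.sum_congr rfl fun i _ => Finset.sum_congr rfl fun j _ => ?_
    ring
  -- `⟨v_c, R v_c⟩` entrywise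
  have hRcc : ∀ c, star (fun i => V i c) ⬝ᵥ (R *ᵥ fun i => V i c) =
      ∑ i, ∑ j, (ΛA i j * (Vᴴ * ((a i)ᴴ * a j) * V) c c + ΛB i j * (Vᴴ * (a j * (a i)ᴴ) * V) c c +
        ((β : ℝ) : ℂ) * (ΛC i j * (Vᴴ * ((a i)ᴴ * (H * a j - a j * H)) * V) c c)) := by
    intro c
    rw [← conjTranspose_mul_mul_apply_same'', hR, Matrix.mul_sum, Matrix.sum_mul, Matrix.sum_apply]
    refine Finset.sum_congr rfl fun i _ => ?_
    rw [Matrix.mul_sum, Matrix.sum_mul, Matrix.sum_apply]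
    refine Finset.sum_congr rfl fun j _ => ?_
    simp only [Matrix.mul_add, Matrix.add_mul, Matrix.mul_smul, Matrix.smul_mul, Matrix.add_apply,
      Matrix.smul_apply, smul_eq_mul]
  -- step 1: pull the `c`-sum inside
  have h1 : ∑ c, w c * (star (fun i => V i c) ⬝ᵥ (R *ᵥ fun i => V i c)) =
      ∑ i, ∑ j, (ΛA i j * ∑ c, w c * (Vᴴ * ((a i)ᴴ * a j) * V) c c +
        ΛB i j * ∑ c, w c * (Vᴴ * (a j * (a i)ᴴ) * V) c c +
        ((β : ℝ) : ℂ) * ΛC i j * ∑ c, w c * (Vᴴ * ((a i)ᴴ * (H * a j - a j * H)) * V) c c) := by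
    simp_rw [hRcc, Finset.mul_sum]
    rw [Finset.sum_comm]
    refine Finset.sum_congr rfl fun i _ => ?_
    rw [Finset.sum_comm]
    refine Finset.sum_congr rfl fun j _ => ?_
    rw [← Finset.sum_add_distrib, ← Finset.sum_add_distrib]
    exact Finset.sum_congr rfl fun c _ => by ring
  -- step 2: insert the three pieces and collect per `(b, c)`
  have h2 : ∀ i j, ΛA i j * ∑ c, w c * (Vᴴ * ((a i)ᴴ * a j) * V) c c +
        ΛB i j * ∑ c, w c * (Vᴴ * (a j * (a i)ᴴ) * V) c c +
        ((β : ℝ) : ℂ) * ΛC i j * ∑ c, w c * (Vᴴ * ((a i)ᴴ * (H * a j - a j * H)) * V) c c =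
      ∑ c, ∑ b, w c * ((ΛA + ((Real.exp (-(β * (E b - E c))) : ℝ) : ℂ) • ΛB +
          ((β * (E b - E c) : ℝ) : ℂ) • ΛC) i j * (star (C i b c) * C j b c)) := by
    intro i j
    rw [tA, tB, tC, Finset.mul_sum, Finset.mul_sum, Finset.mul_sum, ← Finset.sum_add_distrib,
      ← Finset.sum_add_distrib]
    refine Finset.sum_congr rfl fun c _ => ?_
    rw [Finset.mul_sum, Finset.mul_sum, Finset.mul_sum, ← Finset.sum_add_distrib, ← Finset.sum_add_distrib]
    refine Finset.sum_congr rfl fun b _ => ?_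
    have hwb : w b = w c * ((Real.exp (-(β * (E b - E c))) : ℝ) : ℂ) := by
      simp only [hw]
      rw [← Complex.ofReal_mul, ← Real.exp_add]
      ring_nf
    rw [hwb]
    simp only [Matrix.add_apply, Matrix.smul_apply, smul_eq_mul]
    push_cast
    ring
  -- step 3: reorder `Σ_i Σ_j Σ_c Σ_b = Σ_c Σ_b Σ_i Σ_j` and recognise the quadratic forms
  have hcomm4 : ∀ F : m → m → κ → κ → ℂ,
      ∑ i, ∑ j, ∑ c, ∑ b, F i j c b = ∑ c, ∑ b, ∑ i, ∑ j, F i j c b := by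
    intro F
    calc ∑ i, ∑ j, ∑ c, ∑ b, F i j c b
        = ∑ i, ∑ c, ∑ j, ∑ b, F i j c b := Finset.sum_congr rfl fun i _ => Finset.sum_comm
      _ = ∑ c, ∑ i, ∑ j, ∑ b, F i j c b := Finset.sum_comm
      _ = ∑ c, ∑ i, ∑ b, ∑ j, F i j c b :=
          Finset.sum_congr rfl fun c _ => Finset.sum_congr rfl fun i _ => Finset.sum_comm
      _ = ∑ c, ∑ b, ∑ i, ∑ j, F i j c b := Finset.sum_congr rfl fun c _ => Finset.sum_comm
  have hsum : ∑ c, w c * (star (fun i => V i c) ⬝ᵥ (R *ᵥ fun i => V i c)) =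
      ∑ c, ∑ b, w c * (star (fun j => C j b c) ⬝ᵥ ((ΛA + ((Real.exp (-(β * (E b - E c))) : ℝ) : ℂ) • ΛB +
          ((β * (E b - E c) : ℝ) : ℂ) • ΛC) *ᵥ fun j => C j b c)) := by
    rw [h1]
    simp_rw [h2]
    refine (hcomm4 _).trans (Finset.sum_congr rfl fun c _ => Finset.sum_congr rfl fun b _ => ?_)
    rw [← hquad, Finset.mul_sum]
    refine Finset.sum_congr rfl fun i _ => ?_
    rw [Finset.mul_sum]
  -- real parts
  have hre : ∑ c, Real.exp (-(β * E c)) * (star (fun i => V i c) ⬝ᵥ (R *ᵥ fun i => V i c)).re =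
      (∑ c, w c * (star (fun i => V i c) ⬝ᵥ (R *ᵥ fun i => V i c))).re := by
    rw [Complex.re_sum]
    exact Finset.sum_congr rfl fun c _ => by rw [hw, Complex.re_ofReal_mul]
  rw [hre, hsum, Complex.re_sum]
  refine Finset.sum_nonneg fun c _ => ?_
  rw [Complex.re_sum]
  refine Finset.sum_nonneg fun b _ => ?_
  rw [hw, Complex.re_ofReal_mul]
  refine mul_nonneg (Real.exp_pos _).le ?_
  obtain ⟨hq, -⟩ := Complex.nonneg_iff.1 ((hΛ (β * (E b - E c))).dotProduct_mulVec_nonneg (fun j => C j b c))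
  exact hq

end FullSpace

/-! ### §2 The tangent triple: the scalar rows of `GibbsEnergyEntropyBalance.lean` are matrix cuts -/

section Tangent

/-- **The scalar tangent row is a `1 × 1` matrix cut**: for `e^{s−1} ≤ q` the triple
`(Λ_A, Λ_B, Λ_C) = (−s, q, 1)` satisfies `−s + q e^{−x} + x ≥ 0`, i.e. the one-parameter family of
`sum_exp_mul_re_expect_matrixCut_nonneg` is positive semidefinite (`sub_add_mul_exp_neg_nonneg_of_exp_le`).
[cite: FawziFawziScalet2024, Thm. 3.1] -/
theorem posSemidef_tangent_triple {m : Type*} [Fintype m] [DecidableEq m] {s q : ℝ}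
    (hq : Real.exp (s - 1) ≤ q) (x : ℝ) :
    ((-((s : ℝ) : ℂ)) • (1 : Matrix m m ℂ) + ((Real.exp (-x) : ℝ) : ℂ) • (((q : ℝ) : ℂ) • (1 : Matrix m m ℂ)) +
      ((x : ℝ) : ℂ) • (1 : Matrix m m ℂ)).PosSemidef := by
  have h : (-((s : ℝ) : ℂ)) • (1 : Matrix m m ℂ) + ((Real.exp (-x) : ℝ) : ℂ) • (((q : ℝ) : ℂ) • (1 : Matrix m m ℂ)) +
      ((x : ℝ) : ℂ) • (1 : Matrix m m ℂ) = (((x - s + q * Real.exp (-x)) : ℝ) : ℂ) • (1 : Matrix m m ℂ) := by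
    rw [smul_smul, ← add_smul, ← add_smul]
    congr 1
    push_cast
    ring
  rw [h]
  exact Matrix.PosSemidef.one.smul (Complex.zero_le_real.2 (sub_add_mul_exp_neg_nonneg_of_exp_le hq x))

end Tangent

/-! ### §3 Matrix cuts for the canonical eigen-mixture compressed to an invariant coordinate sector -/

section CoordinateSector

variable {ι : Type*} [Fintype ι] [DecidableEq ι] (p : ι → Prop) [DecidablePred p]
variable {m : Type*} [Fintype m]

omit [DecidableEq ι] in
/-- A sum over all coordinates of a function vanishing off the sector is the sum over the sector.
[folklore] -/
private theorem sum_eq_sum_subtype_of_eq_zero_off₃ (f : ι → ℂ) (hf : ∀ i, ¬ p i → f i = 0) :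
    ∑ i, f i = ∑ a : Subtype p, f a.1 := by
  rw [← Finset.sum_subtype (Finset.univ.filter p) (by simp), Finset.sum_filter_of_ne]
  intro i _ hi
  by_contra h
  exact hi (hf i h)

omit [DecidableEq ι] in
/-- `⟨ext φ, X ext φ⟩ = ⟨φ, X|_p φ⟩` for every matrix `X`. [folklore] -/
private theorem star_sectorExtend_dotProduct_mulVec_sectorExtend₃ (X : Matrix ι ι ℂ) (φ : Subtype p → ℂ) :
    star (sectorExtend p φ) ⬝ᵥ (X *ᵥ sectorExtend p φ) =
      star φ ⬝ᵥ (X.submatrix (Subtype.val : Subtype p → ι) Subtype.val *ᵥ φ) := by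
  have hext : ∀ a : Subtype p, sectorExtend p φ a.1 = φ a := fun a => by simp [sectorExtend, a.2]
  have hoff : ∀ i, ¬ p i → sectorExtend p φ i = 0 := fun i hi => by simp [sectorExtend, hi]
  rw [dotProduct, dotProduct, sum_eq_sum_subtype_of_eq_zero_off₃ p]
  · refine Finset.sum_congr rfl fun a _ => ?_
    rw [Pi.star_apply, Pi.star_apply, hext, mulVec, mulVec, dotProduct, dotProduct,
      sum_eq_sum_subtype_of_eq_zero_off₃ p]
    · simp only [Matrix.submatrix_apply, hext]
    · intro j hj
      rw [hoff j hj, mul_zero]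
  · intro i hi
    rw [Pi.star_apply, hoff i hi, star_zero, zero_mul]

omit [DecidableEq ι] in
/-- Right factor maps the sector into itself ⇒ `(M N)|_p = M|_p N|_p`. [folklore] -/
private theorem submatrix_mul_of_right₃ (M N : Matrix ι ι ℂ) (hN : ∀ i j, ¬ p i → p j → N i j = 0) :
    (M * N).submatrix (Subtype.val : Subtype p → ι) (Subtype.val : Subtype p → ι) =
      M.submatrix (Subtype.val : Subtype p → ι) (Subtype.val : Subtype p → ι) *
        N.submatrix (Subtype.val : Subtype p → ι) (Subtype.val : Subtype p → ι) := by
  ext a b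
  rw [Matrix.submatrix_apply, Matrix.mul_apply, Matrix.mul_apply, sum_eq_sum_subtype_of_eq_zero_off₃ p]
  · rfl
  · intro k hk
    rw [hN k b.1 hk b.2, mul_zero]

omit [Fintype ι] [DecidableEq ι] [DecidablePred p] [Fintype m] in
/-- Compression commutes with finite sums of matrices. [folklore] -/
private theorem submatrix_sum₃ (s : Finset m) (M : m → Matrix ι ι ℂ) :
    (∑ i ∈ s, M i).submatrix (Subtype.val : Subtype p → ι) (Subtype.val : Subtype p → ι) =
      ∑ i ∈ s, (M i).submatrix (Subtype.val : Subtype p → ι) (Subtype.val : Subtype p → ι) := by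
  ext a b
  simp only [Matrix.submatrix_apply, Matrix.sum_apply]

/-- **Matrix energy–entropy-balance cuts for the canonical sector Gibbs eigen-mixture.** Let `A` be
Hermitian with no entries between the coordinate sector `p` and its complement, `(w_c, ψ_c)` its
canonical sector eigen-mixture at inverse temperature `β` (`canonicalWeight`, `sectorEigenvector`),
`a : m → Matrix` generators such that every `a_i` and every `a_iᴴ` maps the sector into itself, and
`Λ_A, Λ_B, Λ_C` with `Λ_A + e^{−x} Λ_B + x Λ_C ⪰ 0` for all real `x`. Then
`0 ≤ Σ_c w_c Re⟨ψ_c, R ψ_c⟩` for the matrix cut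
`R = Σ_{ij} (Λ_A)_{ij} a_iᴴ a_j + (Λ_B)_{ij} a_j a_iᴴ + β (Λ_C)_{ij} a_iᴴ (A a_j − a_j A)` — the matrix
energy–entropy-balance rows of the canonical Gibbs state `tr(P_p e^{−βA} ·)/Z_p` for sector-preserving
generators (compress to the sector and apply `sum_exp_mul_re_expect_matrixCut_nonneg`).
[cite: FawziFawziScalet2024, Thm. 3.4] -/
theorem sum_canonicalWeight_mul_re_expect_matrixCut_nonneg {A : Matrix ι ι ℂ} (hA : A.IsHermitian)
    (hinv : ∀ i j, ¬ p i → p j → A i j = 0) {a : m → Matrix ι ι ℂ}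
    (ha : ∀ k i j, ¬ p i → p j → a k i j = 0) (ha' : ∀ k i j, ¬ p i → p j → (a k)ᴴ i j = 0)
    (β : ℝ) {ΛA ΛB ΛC : Matrix m m ℂ}
    (hΛ : ∀ x : ℝ, (ΛA + ((Real.exp (-x) : ℝ) : ℂ) • ΛB + ((x : ℝ) : ℂ) • ΛC).PosSemidef) :
    0 ≤ ∑ c, canonicalWeight β (sectorEigenvalue p A hA) c *
      (star (sectorEigenvector p A hA c) ⬝ᵥ
        ((∑ i, ∑ j, (ΛA i j • ((a i)ᴴ * a j) + ΛB i j • (a j * (a i)ᴴ) +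
            ((β : ℝ) : ℂ) • (ΛC i j • ((a i)ᴴ * (A * a j - a j * A))))) *ᵥ sectorEigenvector p A hA c)).re := by
  set hAp := hA.submatrix (Subtype.val : Subtype p → ι) with hApdef
  set Ap : Matrix (Subtype p) (Subtype p) ℂ := A.submatrix (Subtype.val : Subtype p → ι) Subtype.val with hAp'
  set ap : m → Matrix (Subtype p) (Subtype p) ℂ :=
    fun k => (a k).submatrix (Subtype.val : Subtype p → ι) Subtype.val with hap
  -- compression of the cut
  have hapk : ∀ k, (a k).submatrix (Subtype.val : Subtype p → ι) Subtype.val = ap k := fun k => rfl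
  have hat : ∀ k, ((a k)ᴴ).submatrix (Subtype.val : Subtype p → ι) Subtype.val = (ap k)ᴴ := fun k => by
    rw [← hapk, Matrix.conjTranspose_submatrix]
  have hAB : ∀ k i j, ¬ p i → p j → (A * a k - a k * A) i j = 0 := fun k i j hi hj => by
    rw [Matrix.sub_apply, mul_apply_eq_zero_off p hinv (ha k) i j hi hj,
      mul_apply_eq_zero_off p (ha k) hinv i j hi hj, sub_zero]
  have hsub : (∑ i, ∑ j, (ΛA i j • ((a i)ᴴ * a j) + ΛB i j • (a j * (a i)ᴴ) +
        ((β : ℝ) : ℂ) • (ΛC i j • ((a i)ᴴ * (A * a j - a j * A))))).submatrix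
          (Subtype.val : Subtype p → ι) Subtype.val =
      ∑ i, ∑ j, (ΛA i j • ((ap i)ᴴ * ap j) + ΛB i j • (ap j * (ap i)ᴴ) +
        ((β : ℝ) : ℂ) • (ΛC i j • ((ap i)ᴴ * (Ap * ap j - ap j * Ap)))) := by
    rw [submatrix_sum₃]
    refine Finset.sum_congr rfl fun i _ => ?_
    rw [submatrix_sum₃]
    refine Finset.sum_congr rfl fun j _ => ?_
    simp only [Matrix.submatrix_add, Matrix.submatrix_smul, Matrix.submatrix_sub, Pi.add_apply, Pi.smul_apply,
      Pi.sub_apply, submatrix_mul_of_right₃ p (a i)ᴴ (a j) (ha j), submatrix_mul_of_right₃ p (a j) (a i)ᴴ (ha' i),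
      submatrix_mul_of_right₃ p (a i)ᴴ (A * a j - a j * A) (hAB j), submatrix_mul_of_right₃ p A (a j) (ha j),
      submatrix_mul_of_right₃ p (a j) A hinv, hat, ← hAp', hapk]
  have hterm : ∀ c : Subtype p,
      star (sectorEigenvector p A hA c) ⬝ᵥ
        ((∑ i, ∑ j, (ΛA i j • ((a i)ᴴ * a j) + ΛB i j • (a j * (a i)ᴴ) +
            ((β : ℝ) : ℂ) • (ΛC i j • ((a i)ᴴ * (A * a j - a j * A))))) *ᵥ sectorEigenvector p A hA c) =
      star (fun b => (hAp.eigenvectorUnitary : Matrix (Subtype p) (Subtype p) ℂ) b c) ⬝ᵥ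
        ((∑ i, ∑ j, (ΛA i j • ((ap i)ᴴ * ap j) + ΛB i j • (ap j * (ap i)ᴴ) +
            ((β : ℝ) : ℂ) • (ΛC i j • ((ap i)ᴴ * (Ap * ap j - ap j * Ap))))) *ᵥ
          fun b => (hAp.eigenvectorUnitary : Matrix (Subtype p) (Subtype p) ℂ) b c) := by
    intro c
    rw [sectorEigenvector, star_sectorExtend_dotProduct_mulVec_sectorExtend₃, hsub]
  have hw : ∀ c : Subtype p, canonicalWeight β (sectorEigenvalue p A hA) c =
      (∑ b, Real.exp (-(β * hAp.eigenvalues b)))⁻¹ * Real.exp (-(β * hAp.eigenvalues c)) := fun c => rfl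
  simp_rw [hterm, hw, mul_assoc, ← Finset.mul_sum]
  exact mul_nonneg (inv_nonneg.2 (Finset.sum_nonneg fun _ _ => (Real.exp_pos _).le))
    (sum_exp_mul_re_expect_matrixCut_nonneg hAp ap β hΛ)

end CoordinateSector

end Literature.MathematicalPhysics.QuantumLattice

end
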